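import Literature.NumberTheory.LFunctions.FordLemma36Constants
import Literature.NumberTheory.LFunctions.FordVinogradovToolkit
import HarnessLib

/-!
# The row `(ρ, θ) = (3.21432, 2.3291)` of Ford's (1.7) for `k ≥ 1191` from the data of Lemma 3.5

Topic `Literature/NumberTheory/LFunctions`. Everything here is PROVED (no named facts). Fourth file of
the definition-free formalization of K. Ford, Proc. LMS 85 (2002), Lemma 3.6 / Theorem 3, first part.

"Proof of Theorem 3. Suppose first that `k ≥ 1000`. Every permissible `s` can be written as `s = nk + u`
… By Lemma 3.6 and Hölder's inequality … `Δ ≤ (3/8)k²e^{1/2−2s/k²+1.7/k}`." Combining the closed forms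
`FordL36.delta_le_closed_form` (`Δ_n ≤ (3/8)k²e^{1/2−2n/k+2.03/k}`) and `FordL36.C_le_closed_form` with
the tree's Hölder interpolation in the number of variables (`FordVK.J_interpolate`) gives, from the
conclusion of Lemma 3.5 taken as a hypothesis on abstract data `(Δ_n = k²δ_n, C_n)`,

* `FordL36.row_of_lemma35_data` — **for `k ≥ 1191`: there is `s ≤ 3.21432k²` with
  `J_{s,k}(P) ≤ k^{2.3291k³} P^{2s − k(k+1)/2 + 0.001k²}` (`P ≥ 1`)** — the row of (1.7) used for
  `k ≥ 200` in §5, in the exact shape of the hypothesis `hT3a` of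
  `zeta_bound_ford_of_theorem3_theorem4` / `FordVK.expSum_bound_lambda_ge_87`.

The threshold: with `s = nk + u`, the interpolated exponent is at most
`(3/8)k²e^{1/2−2n/k+2.03/k}(1 − u/k + (u/k)e^{−2/k}) ≤ (3/8)k²e^{1/2−2s/k²+2.034/k}` (`chord_exp_le`), which is
`≤ 0.001k²` as soon as `s ≥ 3.213465k² + 1.017k` (`log 375 ≤ 5.92693`, `log_375_le`); an integer `s` of
this size below `3.21432k²` exists once `0.000855k² ≥ 1.017k + 1`, i.e. `k ≥ 1191`. (With the printed
`1.69/k` Ford gets `k ≥ 994`, whence his computation up to `k = 1001`; with the constants proved in the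
tree the computed range of the second part of Theorem 3 has to reach `k = 1190`.) The constant:
`C_le_theta`, `k^{2.06k³−5.91k²+3mk}1.06^{mk²+2(m²−m)k−9.7278k³} ≤ k^{2.3291k³}` for `m ≤ 3.22k + 2`.

## References

* K. Ford, *Vinogradov's integral and bounds for the Riemann zeta function*, Proc. London Math.
  Soc. (3) 85 (2002), 565–633; arXiv:1910.08209: Theorem 3 and its proof ("Suppose first that
  k ≥ 1000"), Lemmas 3.5–3.6, (1.7). [Ford2002]
-/

noncomputable section

open Real Set Finset

namespace Literature.NumberTheory.LFunctions

namespace FordL36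

/-- `log 375 ≤ 5.92693` (`375 = 1024/(e · (1024/(375e)))`, `log(1+x) ≥ x − x²/2`). [folklore] -/
theorem log_375_le : Real.log 375 ≤ 5.92693 := by
  have h2 := Real.log_two_lt_d9
  have he := Real.exp_one_lt_d9
  have he0 := Real.exp_pos (1 : ℝ)
  -- `log 375 = 10 log 2 − 1 − log(1024/(375 e))`
  have e1 : Real.log 375 = 10 * Real.log 2 - 1 - Real.log (1024 / (375 * Real.exp 1)) := by
    rw [Real.log_div (by norm_num) (by positivity), Real.log_mul (by norm_num) he0.ne', Real.log_exp,
      show (1024 : ℝ) = 2 ^ 10 by norm_num, Real.log_pow]; push_cast; ring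
  -- `1024/(375e) ≥ 1.004556` and `log(1.004556) ≥ 0.004556 − 0.004556²/2`
  have hq : (1.004556 : ℝ) ≤ 1024 / (375 * Real.exp 1) := by
    rw [le_div_iff₀ (by positivity)]; nlinarith
  have hlog : 0.004556 - 0.004556 ^ 2 / 2 ≤ Real.log (1024 / (375 * Real.exp 1)) := by
    have h1 : Real.log 1.004556 ≤ Real.log (1024 / (375 * Real.exp 1)) := Real.log_le_log (by norm_num) hq
    have h2 : 0.004556 - 0.004556 ^ 2 / 2 ≤ Real.log 1.004556 := by
      have := Real.one_sub_inv_le_log_of_pos (show (0:ℝ) < 1.004556 by norm_num)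
      -- `1 − 1/1.004556 = 0.0045353…`, weaker than needed: use the cubic bound instead
      have h3 := FordL34.log_one_add_le_cubic (x := (-0.004556 / 1.004556 : ℝ)) (by norm_num)
      -- log(1 + (−a/(1+a))) = −log(1+a)
      have e : (1 : ℝ) + -0.004556 / 1.004556 = (1.004556)⁻¹ := by norm_num
      rw [e, Real.log_inv] at h3
      norm_num at h3 ⊢
      linarith
    linarith
  rw [e1]; nlinarith

/-- `e^{−x} ≤ 1 − x + x²` for `x ≥ 0` (`e^{−x} ≤ 1/(1+x)`). [folklore] -/
theorem exp_neg_le_one_sub_add_sq {x : ℝ} (hx : 0 ≤ x) : Real.exp (-x) ≤ 1 - x + x ^ 2 := by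
  have h1 : Real.exp (-x) ≤ 1 / (1 + x) := by
    rw [Real.exp_neg, one_div]
    exact inv_anti₀ (by linarith) (by linarith [Real.add_one_le_exp x])
  have h2 : 1 / (1 + x) ≤ 1 - x + x ^ 2 := by
    rw [div_le_iff₀ (by linarith)]; nlinarith [pow_nonneg hx 3]
  linarith

/-- The chord of the exponential: `(1 − t) + t e^{−x} ≤ e^{−tx + tx²}` for `x ≥ 0`, `0 ≤ t ≤ 1`.
[cite: Ford2002, proof of Theorem 3 ("1 − u/k + (u/k)e^{−2/k} ≤ … ≤ e^{−2u/k²+2u/k³}")] -/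
theorem chord_exp_le {x t : ℝ} (hx : 0 ≤ x) (ht0 : 0 ≤ t) :
    (1 - t) + t * Real.exp (-x) ≤ Real.exp (-(t * x) + t * x ^ 2) := by
  have h1 := exp_neg_le_one_sub_add_sq hx
  have h2 := Real.add_one_le_exp (-(t * x) + t * x ^ 2)
  nlinarith [mul_le_mul_of_nonneg_left h1 ht0]

variable {k : ℕ} (hk : 1191 ≤ k) {d : ℕ → ℝ} (h1 : d 1 = (1 - 1 / (k : ℝ)) / 2)
  (hanti : ∀ n, 1 ≤ n → d (n + 1) ≤ d n)
  (hrec : ∀ n, 1 ≤ n → 1 / (k : ℝ) < d n → d (n + 1) ≤ F k (d n))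
  (hlow : ∀ n, 1 ≤ n → 1 / (k : ℝ) < d n → d n * (1 - 2 / (k : ℝ)) ≤ d (n + 1))
  (hdpos : ∀ n, 1 ≤ n → 0 ≤ d n)
  {C : ℕ → ℝ} (hCpos : ∀ n, 1 ≤ n → 0 < C n) (hC1 : C 1 = (Nat.factorial k : ℝ))
  (hC : ∀ n, 2 ≤ n → C n ≤ C (n - 1) *
    max (Hn k n) (Vk k ^ (((k : ℝ) + 1) * ((k : ℝ) ^ 2 * d (n - 1) - (k : ℝ) ^ 2 * d n))))
  (hJ : ∀ n : ℕ, 1 ≤ n → n ≤ k ^ 2 → ∀ P : ℕ, 1 ≤ P →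
    (VMV.J k (n * k) (Finset.Icc (1 : ℤ) P) : ℝ) ≤
      C n * (P : ℝ) ^ ((2 * (n * k : ℕ) : ℝ) - ((k * (k + 1) / 2 : ℕ) : ℝ) + (k : ℝ) ^ 2 * d n))

include hk h1 hanti hrec hlow hdpos hCpos hC1 hC in
/-- The constant at any index `m ∈ [2k, 3.22k + 2]` is below `k^{2.3291 k³}`. [cite: Ford2002, Theorem 3 (the value of `θ` for `k ≥ 200`)] -/
theorem C_le_theta {m : ℕ} (hm1 : 2 * k ≤ m) (hm2 : (m : ℝ) ≤ 3.22 * k + 2) :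
    C m ≤ (k : ℝ) ^ ((2.3291 : ℝ) * (k : ℝ) ^ 3) := by
  have hk1000 : 1000 ≤ k := le_trans (by norm_num) hk
  have hkr : (1191 : ℝ) ≤ k := by exact_mod_cast hk
  have hk0 : (0 : ℝ) < k := by linarith
  have h := C_le_closed_form hk1000 h1 hanti hrec hlow hCpos hC hdpos hC1 hm1
  refine h.trans ?_
  have hL := log_ge_69 (show (1000:ℝ) ≤ k by linarith)
  have hl := log_106_le
  have hl0 := log_106_pos
  rw [Real.rpow_def_of_pos hk0, Real.rpow_def_of_pos (by norm_num), ← Real.exp_add, Real.rpow_def_of_pos hk0,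
    Real.exp_le_exp]
  set L := Real.log (k : ℝ) with hLdef
  set l := Real.log (1.06 : ℝ) with hldef
  -- polynomial comparisons in `k` and `m`
  have c1 : (2.06 : ℝ) * (k : ℝ) ^ 3 - 5.91 * (k : ℝ) ^ 2 + 3 * m * k ≤ 2.064 * (k : ℝ) ^ 3 := by nlinarith
  have c2 : (m : ℝ) * (k : ℝ) ^ 2 + 2 * ((m : ℝ) ^ 2 - m) * k - 9.7278 * (k : ℝ) ^ 3 ≤ 14.3 * (k : ℝ) ^ 3 := by
    have hm0 : (0 : ℝ) ≤ m := Nat.cast_nonneg _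
    nlinarith [mul_le_mul_of_nonneg_left hm2 (by positivity : (0:ℝ) ≤ (k : ℝ) ^ 2),
      mul_le_mul hm2 hm2 hm0 (by positivity)]
  have hLge : 0 ≤ L := by linarith
  have f1 := mul_le_mul_of_nonneg_right c1 hLge
  have f2 := mul_le_mul_of_nonneg_right c2 hl0.le
  have f3 : 14.3 * (k : ℝ) ^ 3 * l ≤ 14.3 * (k : ℝ) ^ 3 * 0.058272 := mul_le_mul_of_nonneg_left hl (by positivity)
  have f4 : 14.3 * (k : ℝ) ^ 3 * 0.058272 ≤ 0.265 * (k : ℝ) ^ 3 * L := by nlinarith [pow_pos hk0 3]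
  nlinarith [f1, f2, f3, f4, pow_pos hk0 3]

set_option maxHeartbeats 1000000 in
include hk h1 hanti hrec hlow hdpos hCpos hC1 hC hJ in
/-- **The row `(ρ, θ) = (3.21432, 2.3291)` of (1.7) for `k ≥ 1191` from the data of Lemma 3.5**
(the deduction "Proof of Theorem 3, first part" of the source, with the closed forms of
`FordLemma36Recursion` / `FordLemma36Constants`): there is `s ≤ 3.21432 k²` with
`J_{s,k}(P) ≤ k^{2.3291k³} P^{2s − k(k+1)/2 + 0.001k²}` (`P ≥ 1`). With `s = nk + u` (`0 ≤ u < k`),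
`J_s ≤ J_{nk}^{1−u/k} J_{(n+1)k}^{u/k}` (Hölder), the exponent being at most
`(3/8)k² e^{1/2−2n/k+2.03/k}(1 − u/k + (u/k)e^{−2/k}) ≤ (3/8)k²e^{1/2−2s/k²+2.034/k} ≤ 0.001k²` for
`s ≥ 3.213465k² + 1.017k` (`log 375 ≤ 5.92693`); such an `s ≤ 3.21432k²` exists once
`0.000855k² ≥ 1.017k + 1`, i.e. `k ≥ 1191` (Ford, with `1.69`: `k ≥ 994`, whence his computation to `1001`).
[cite: Ford2002, Theorem 3 (second part, row `k ≥ 200`) and the proof of Theorem 3 ("Suppose first that k ≥ 1000 …")] -/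
theorem row_of_lemma35_data :
    ∃ s₃ : ℕ, 1 ≤ s₃ ∧ (s₃ : ℝ) ≤ 3.21432 * (k : ℝ) ^ 2 ∧ ∀ P : ℕ, 1 ≤ P →
      (VMV.J k s₃ (Finset.Icc (1 : ℤ) P) : ℝ) ≤ (k : ℝ) ^ ((2.3291 : ℝ) * (k : ℝ) ^ 3)
        * (P : ℝ) ^ ((2 * s₃ : ℝ) - ((k * (k + 1) / 2 : ℕ) : ℝ) + 0.001 * (k : ℝ) ^ 2) := by
  have hk1000 : 1000 ≤ k := le_trans (by norm_num) hk
  have hkr : (1191 : ℝ) ≤ k := by exact_mod_cast hk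
  have hkr' : (1000 : ℝ) ≤ k := by linarith
  have hk0 : (0 : ℝ) < k := by linarith
  have hkpos : 0 < k := by omega
  -- the choice of `s₃ = nk + u`
  obtain ⟨s₃, hs₃⟩ : ∃ s : ℕ, s = ⌈(3.213465 : ℝ) * (k : ℝ) ^ 2 + 1.017 * k⌉₊ := ⟨_, rfl⟩
  have hs₃ge : (3.213465 : ℝ) * (k : ℝ) ^ 2 + 1.017 * k ≤ s₃ := by rw [hs₃]; exact Nat.le_ceil _
  have hs₃le : (s₃ : ℝ) ≤ 3.213465 * (k : ℝ) ^ 2 + 1.017 * k + 1 := by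
    have := Nat.ceil_lt_add_one (show (0:ℝ) ≤ 3.213465 * (k : ℝ) ^ 2 + 1.017 * k by positivity)
    rw [← hs₃] at this; linarith
  have hs₃max : (s₃ : ℝ) ≤ 3.21432 * (k : ℝ) ^ 2 := by nlinarith
  have hs₃1 : 1 ≤ s₃ := by
    have : (1 : ℝ) ≤ s₃ := by nlinarith
    exact_mod_cast this
  obtain ⟨n, hn⟩ : ∃ m : ℕ, m = s₃ / k := ⟨_, rfl⟩
  obtain ⟨u, hu⟩ : ∃ m : ℕ, m = s₃ % k := ⟨_, rfl⟩
  have hsplit : s₃ = n * k + u := by rw [hn, hu, mul_comm]; exact (Nat.div_add_mod s₃ k).symm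
  have huk : u < k := by rw [hu]; exact Nat.mod_lt _ hkpos
  have hsr : (s₃ : ℝ) = n * k + u := by rw [hsplit]; push_cast; ring
  have hur : (u : ℝ) < k := by exact_mod_cast huk
  have hur' : (u : ℝ) ≤ k := hur.le
  have hu0 : (0 : ℝ) ≤ u := Nat.cast_nonneg _
  -- ranges of `n`
  have hn_lo : (3.21 : ℝ) * k ≤ n := by nlinarith
  have hn_hi : (n : ℝ) ≤ 3.2144 * k + 1 := by nlinarith
  have hn2k : 2 * k ≤ n := by
    have : (2 : ℝ) * k ≤ n := by linarith
    exact_mod_cast this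
  have hn2k' : 2 * k ≤ n + 1 := by omega
  have hnk2 : n + 1 ≤ k ^ 2 := by
    have : (n : ℝ) + 1 ≤ (k : ℝ) ^ 2 := by nlinarith
    exact_mod_cast this
  have hlogk : 6 ≤ Real.log (3 * (k : ℝ) / 8) := by
    rw [Real.le_log_iff_exp_le (by positivity)]
    have he := Real.exp_one_lt_d9
    have : Real.exp 6 = Real.exp 1 ^ 6 := by rw [← Real.exp_nat_mul]; norm_num
    rw [this]
    have h6 : Real.exp 1 ^ 6 ≤ 2.7182818286 ^ 6 := pow_le_pow_left₀ (Real.exp_pos 1).le he.le 6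
    nlinarith
  have hrange : ∀ m : ℕ, (m : ℝ) ≤ 3.2144 * k + 2 → (m : ℝ) ≤ (k : ℝ) / 2 * (1 / 2 + Real.log (3 * k / 8)) + 1 := by
    intro m hm; nlinarith
  -- the closed forms for `d n`, `d (n+1)`
  have hdn := delta_le_closed_form hkr' h1 hanti hrec (n := n) (by exact_mod_cast hn2k) (hrange n (by linarith))
  have hdn1 := delta_le_closed_form hkr' h1 hanti hrec (n := n + 1) (by push_cast; linarith)
    (hrange (n + 1) (by push_cast; linarith))
  -- the constants
  have hCn : C n ≤ (k : ℝ) ^ ((2.3291 : ℝ) * (k : ℝ) ^ 3) :=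
    C_le_theta hk h1 hanti hrec hlow hdpos hCpos hC1 hC hn2k (by linarith)
  have hCn1 : C (n + 1) ≤ (k : ℝ) ^ ((2.3291 : ℝ) * (k : ℝ) ^ 3) :=
    C_le_theta hk h1 hanti hrec hlow hdpos hCpos hC1 hC hn2k' (by push_cast; linarith)
  -- the key exponent estimate: `(1−t) d n + t d (n+1) ≤ 0.001`, `t = u/k`
  set t : ℝ := (u : ℝ) / k with htdef
  have ht0 : 0 ≤ t := by positivity
  have ht1 : t ≤ 1 := by rw [htdef, div_le_one hk0]; linarith
  have hkey : (1 - t) * d n + t * d (n + 1) ≤ 0.001 := by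
    have eX' : Real.exp (1 / 2 - 2 * ((n + 1 : ℕ) : ℝ) / k + 2.03 / k) =
        Real.exp (1 / 2 - 2 * (n : ℝ) / k + 2.03 / k) * Real.exp (-(2 / k)) := by
      rw [← Real.exp_add]; congr 1; push_cast; field_simp; ring
    rw [eX'] at hdn1
    have hchord := chord_exp_le (show (0:ℝ) ≤ 2 / k by positivity) ht0
    have hb0 : 0 ≤ 3 / 8 * Real.exp (1 / 2 - 2 * (n : ℝ) / k + 2.03 / k) := by positivity
    have e1 : 2 * (n : ℝ) / k + t * (2 / k) = 2 * (s₃ : ℝ) / k ^ 2 := by rw [hsr, htdef]; field_simp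
    have e2 : t * (2 / k) ^ 2 = 4 * u / k ^ 3 := by rw [htdef]; field_simp; ring
    have h4 : 4 * (u : ℝ) / k ^ 3 ≤ 0.004 / k := by
      rw [div_le_div_iff₀ (by positivity) hk0]
      have h41 : 4 * (u : ℝ) * k ≤ 4 * k * k :=
        mul_le_mul_of_nonneg_right (by linarith only [hur']) hk0.le
      have h42 : 0 ≤ (k : ℝ) ^ 2 * (0.004 * k - 4) := mul_nonneg (sq_nonneg _) (by linarith only [hkr'])
      have e4 : 0.004 * (k : ℝ) ^ 3 - 4 * k * k = (k : ℝ) ^ 2 * (0.004 * k - 4) := by ring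
      linarith only [h41, h42, e4]
    have h5 : 6.42693 + 2.034 / k ≤ 2 * (s₃ : ℝ) / k ^ 2 := by
      have e3 : (6.42693 : ℝ) + 2.034 / k = (6.42693 * (k : ℝ) ^ 2 + 2.034 * k) / k ^ 2 := by
        rw [eq_div_iff (by positivity)]; field_simp
      rw [e3]
      exact div_le_div_of_nonneg_right (by linarith only [hs₃ge]) (by positivity)
    have h6 : 2.03 / (k : ℝ) + 0.004 / k = 2.034 / k := by ring
    have hexp : 1 / 2 - 2 * (n : ℝ) / k + 2.03 / k + (-(t * (2 / k)) + t * (2 / k) ^ 2) ≤ -5.92693 := by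
      rw [e2]; linarith only [e1, h4, h5, h6]
    have hl := log_375_le
    have h375 : Real.exp (-5.92693) ≤ 1 / 375 := by
      have h1' : Real.exp (-5.92693) ≤ Real.exp (-Real.log 375) := Real.exp_le_exp.2 (by linarith)
      have e : Real.exp (-Real.log 375) = 1 / 375 := by
        rw [Real.exp_neg, Real.exp_log (by norm_num), one_div]
      linarith
    calc (1 - t) * d n + t * d (n + 1)
        ≤ (1 - t) * (3 / 8 * Real.exp (1 / 2 - 2 * (n : ℝ) / k + 2.03 / k)) +
            t * (3 / 8 * (Real.exp (1 / 2 - 2 * (n : ℝ) / k + 2.03 / k) * Real.exp (-(2 / k)))) :=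
          add_le_add (mul_le_mul_of_nonneg_left hdn (by linarith)) (mul_le_mul_of_nonneg_left hdn1 ht0)
      _ = (3 / 8 * Real.exp (1 / 2 - 2 * (n : ℝ) / k + 2.03 / k)) * ((1 - t) + t * Real.exp (-(2 / k))) := by ring
      _ ≤ (3 / 8 * Real.exp (1 / 2 - 2 * (n : ℝ) / k + 2.03 / k)) * Real.exp (-(t * (2 / k)) + t * (2 / k) ^ 2) :=
          mul_le_mul_of_nonneg_left hchord hb0
      _ = 3 / 8 * Real.exp (1 / 2 - 2 * (n : ℝ) / k + 2.03 / k + (-(t * (2 / k)) + t * (2 / k) ^ 2)) := by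
          rw [mul_assoc, ← Real.exp_add]
      _ ≤ 3 / 8 * Real.exp (-5.92693) := mul_le_mul_of_nonneg_left (Real.exp_le_exp.2 hexp) (by norm_num)
      _ ≤ 0.001 := by linarith
  -- Hölder interpolation and assembly
  refine ⟨s₃, hs₃1, hs₃max, fun P hP ↦ ?_⟩
  have hP0 : (0 : ℝ) < P := by exact_mod_cast hP
  have hP1 : (1 : ℝ) ≤ P := by exact_mod_cast hP
  set T : ℝ := ((k * (k + 1) / 2 : ℕ) : ℝ) with hT
  set M : ℝ := (k : ℝ) ^ ((2.3291 : ℝ) * (k : ℝ) ^ 3) with hM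
  have hM0 : 0 < M := Real.rpow_pos_of_pos hk0 _
  have hJa := hJ n (by omega) (by omega) P hP
  have hJb := hJ (n + 1) (by omega) hnk2 P hP
  set Ea : ℝ := (2 * (n * k : ℕ) : ℝ) - T + (k : ℝ) ^ 2 * d n with hEa
  set Eb : ℝ := (2 * ((n + 1) * k : ℕ) : ℝ) - T + (k : ℝ) ^ 2 * d (n + 1) with hEb
  have hint := FordVK.J_interpolate k (Finset.Icc (1 : ℤ) P) (a := n * k) (s := s₃) (b := (n + 1) * k)
    (by rw [hsplit]; omega) (by rw [hsplit]; nlinarith) (by nlinarith)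
  have eθa : ((((n + 1) * k : ℕ) : ℝ) - (s₃ : ℝ)) / ((((n + 1) * k : ℕ) : ℝ) - ((n * k : ℕ) : ℝ)) = 1 - t := by
    rw [hsr, htdef]; push_cast; field_simp; ring
  have eθb : ((s₃ : ℝ) - ((n * k : ℕ) : ℝ)) / ((((n + 1) * k : ℕ) : ℝ) - ((n * k : ℕ) : ℝ)) = t := by
    rw [hsr, htdef]; push_cast; field_simp; ring
  rw [eθa, eθb] at hint
  have hJa0 : (0 : ℝ) ≤ (VMV.J k (n * k) (Finset.Icc (1 : ℤ) P) : ℝ) := Nat.cast_nonneg _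
  have hJb0 : (0 : ℝ) ≤ (VMV.J k ((n + 1) * k) (Finset.Icc (1 : ℤ) P) : ℝ) := Nat.cast_nonneg _
  have hCn0 := (hCpos n (by omega)).le
  have hCn10 := (hCpos (n + 1) (by omega)).le
  have h1t : 0 ≤ 1 - t := by linarith
  -- the two factors
  have hA : (VMV.J k (n * k) (Finset.Icc (1 : ℤ) P) : ℝ) ^ (1 - t) ≤ (C n) ^ (1 - t) * (P : ℝ) ^ (Ea * (1 - t)) := by
    calc (VMV.J k (n * k) (Finset.Icc (1 : ℤ) P) : ℝ) ^ (1 - t) ≤ (C n * (P : ℝ) ^ Ea) ^ (1 - t) :=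
          Real.rpow_le_rpow hJa0 hJa h1t
      _ = (C n) ^ (1 - t) * (P : ℝ) ^ (Ea * (1 - t)) := by
          rw [Real.mul_rpow hCn0 (by positivity), ← Real.rpow_mul hP0.le]
  have hB : (VMV.J k ((n + 1) * k) (Finset.Icc (1 : ℤ) P) : ℝ) ^ t ≤ (C (n + 1)) ^ t * (P : ℝ) ^ (Eb * t) := by
    calc (VMV.J k ((n + 1) * k) (Finset.Icc (1 : ℤ) P) : ℝ) ^ t ≤ (C (n + 1) * (P : ℝ) ^ Eb) ^ t :=
          Real.rpow_le_rpow hJb0 hJb ht0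
      _ = (C (n + 1)) ^ t * (P : ℝ) ^ (Eb * t) := by
          rw [Real.mul_rpow hCn10 (by positivity), ← Real.rpow_mul hP0.le]
  -- the constants combine to `M`
  have hCC : (C n) ^ (1 - t) * (C (n + 1)) ^ t ≤ M := by
    calc (C n) ^ (1 - t) * (C (n + 1)) ^ t ≤ M ^ (1 - t) * M ^ t :=
          mul_le_mul (Real.rpow_le_rpow hCn0 hCn h1t) (Real.rpow_le_rpow hCn10 hCn1 ht0)
            (by positivity) (by positivity)
      _ = M := by rw [← Real.rpow_add hM0]; norm_num
  -- the exponents combine to `2 s₃ − T + k²((1−t) d n + t d(n+1)) ≤ 2 s₃ − T + 0.001 k²`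
  have eE : Ea * (1 - t) + Eb * t = (2 * s₃ : ℝ) - T + (k : ℝ) ^ 2 * ((1 - t) * d n + t * d (n + 1)) := by
    rw [hEa, hEb, hsr, htdef]; push_cast; field_simp; ring
  have hE : Ea * (1 - t) + Eb * t ≤ (2 * s₃ : ℝ) - T + 0.001 * (k : ℝ) ^ 2 := by
    rw [eE]; nlinarith [mul_le_mul_of_nonneg_left hkey (by positivity : (0:ℝ) ≤ (k : ℝ) ^ 2)]
  calc (VMV.J k s₃ (Finset.Icc (1 : ℤ) P) : ℝ)
      ≤ (VMV.J k (n * k) (Finset.Icc (1 : ℤ) P) : ℝ) ^ (1 - t) * (VMV.J k ((n + 1) * k) (Finset.Icc (1 : ℤ) P) : ℝ) ^ t := hint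
    _ ≤ ((C n) ^ (1 - t) * (P : ℝ) ^ (Ea * (1 - t))) * ((C (n + 1)) ^ t * (P : ℝ) ^ (Eb * t)) :=
        mul_le_mul hA hB (by positivity) (by positivity)
    _ = ((C n) ^ (1 - t) * (C (n + 1)) ^ t) * (P : ℝ) ^ (Ea * (1 - t) + Eb * t) := by
        rw [Real.rpow_add hP0]; ring
    _ ≤ M * (P : ℝ) ^ ((2 * s₃ : ℝ) - T + 0.001 * (k : ℝ) ^ 2) :=
        mul_le_mul hCC (Real.rpow_le_rpow_of_exponent_le hP1 hE) (by positivity) hM0.le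

end FordL36
end Literature.NumberTheory.LFunctions
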